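import Summits.QuantumFields.YangMills.Theorems.BalabanUVNodesN27AtSpineReadingOfRecord13CoPHV

/-!
# ★ (t-JC) EDITION — THE LARGE-FIELD CUT READ PER TUPLE (plan g81 K3⁷ SKELETON v3 02f6f498332fdbee, registered 01:30Z 2026-08-28, pub-ymgap INBOX l.26426:
# `CutReading := (F θ hP g₀ os) → ℕ → ℕ`, `PinnedAtLive jc sh cr := ∀ F θ hP g₀ os, LiveSel F θ → cr F θ hP g₀ os = crOfRecord₁₃V (jc F θ hP g₀ os) sh F θ hP g₀ os`) of this lineage's
# V-edition module `Thm/BalabanUVNodesN27AtSpineReadingOfRecord13CoPHV` (p591895; tuple-BLIND `jcut : ℕ → ℕ`): the SAME four faces at the spine reading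
# `cr := fun F θ hP g₀ os ↦ YMDAG.UVSplit.crOfRecord₁₃VAt K₀ (jc F θ hP g₀ os) sh F θ hP g₀ os` — at `K₀ = 0` LITERALLY v3's pinned witness `crOfRecord₁₃V (jc F θ hP g₀ os) sh F θ hP g₀ os`
# (`crOfRecord₁₃V_eq`, `rfl`) — every per-tuple binder reading `badClass₁₃ θ K₀ g₀ (jc F θ hP g₀ os)` where the parent read `badClass₁₃ θ K₀ g₀ jcut`, and every dag-n20-d face lemma
# `relWeightBound_∕shellWeightBound_∕core_crOfRecord₁₃VAt` applied per tuple at `jcut := jc F θ hP g₀ os` («zero new tree defs», plan (t-JC)); the extraction face per tuple is §0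
# (E1∕E2 do not read the cut).  A tuple-blind policy is the constant reading `fun _ _ _ _ _ ↦ jcut` (v3 strictly widens v2's dial), so p591895's faces are the special case.
# BalabanUVNodes ∕ N27 = binder B5 AT THE RECORD — N27 AT dag-n20-d's STAGE-13 `CoPH` SPINE READING OF RECORD, PHYSICAL VOLUME, **CUT READ PER TUPLE**
# (cell `pub-ymgap`, HUMAN RULING D-0062 Track A, R134 seat `pub-ymgap-dag-n27-c` (N27 B5 composite, s2) gen 12, HOME trigger (t3) «plan K3⁷ v3 ⇒ re-cut the `PinnedAtLive`-shaped
# storeys»; K3⁷ `SpineGivenEndpointR13SepCoPH` = stmt-QuantumFields-20544, `--kind proof --supports 20544 --as helper`; COUNT-NEUTRAL; THEOREMS ONLY, 0 `def`, 0 `sorry`; `N`-generic,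
# `K₀`-generic, regime-generic, NO Theses import — the item faces in v3's `PinnedAtLive jc sh cr` live∕off-live split are leaf HC `…N27SpineGivenEndpointR13SepCoPHSpineReadingOfRecordVCut`)

WHAT IS KERNEL-CHECKED ([bookkeeping]; each ONE application of the parent with dag-n20-d's transfers in the K5 slots, per tuple).
* §0 `keyedExtraction_crOfRecord₁₃VAt_cut` — the extraction face (`0 < l₀`, `0 < vol = (2L^m)⁴`, E1 ∕ E2 for EVERY `g₀`) AT THE PER-TUPLE-CUT READING under the live-selector pin and
  B‴ §2's three laws: dag-n20-d's `schemeZ_(succ_)eq_sum_classSet_weight{A,B}` BY NAME (the cut enters only `Bad`, which E1∕E2 do not read).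
* §1 ★★ `spine_rec13CCoPHOn_at_crOfRecord₁₃VAt_cut_of_keyedFacesP` — (P) `spine_rec13CCoPHOn_of_keyedFacesP` at the per-tuple-cut reading: ARBITRARY rates predicate `P` and rate
  reading `rr`, K5 side in witness form + the extraction pin∕laws ⇒ `Spine` at `IsRecordOfRecord₁₃CCoPHOn F N Rg`.
* §2 ★★ `spine_rec13CCoPHOn_of_homes₁₃CoPHOn_holder_at_crOfRecord₁₃VAt_cut` — (Q) §1 at the per-tuple-cut reading: the five K4 SENTENCES + `S_D4` at dag-n22-e's regime home
  `RRec₁₃CoPHOn 𝔯 Rg` of ANY Stage-13 rate reading `𝔯` (R-β, N17 GLUED by dag-n17-a `s_N17_of_D4_N18`), K5 side in witness form + pin∕laws, the N19′ edge reading `∀ k, RatesHolderAt … β`.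
* §3 ON THE LIVE-SELECTOR LINE (v3 `LiveSel`, spelled `N`-generically; `hsel` DISCHARGED off the regime with `E := EOfRecord₁₃ F N θ.toStage13Params`):
  ★★ `spine_rec13CCoPHOn_live_at_crOfRecord₁₃VAt_cut_of_keyedFacesP` · ★★ `spine_rec13CCoPHOn_live_of_homes₁₃CoPHOn_holder_at_crOfRecord₁₃VAt_cut` — what a v3 `stub_expansion13H`
  prover working per tuple at the pinned reading meets: N20 ∕ N21 ∕ N19′ in WITNESS form at the reading's named carriers with ITS OWN cut depth `jc F θ hP g₀ os`, the extraction
  slot a THEOREM.  (Off the live line: U `spine_rec13CCoPHOn_of_split` + leaf HC.)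
Consumed BY NAME: dag-n20-d `crOfRecord₁₃VAt`, `classSet₁₃`, `weightA₁₃`, `weightB₁₃`, `badClass₁₃`, `ShellSplit₁₃CoPH`, `relWeightBound_crOfRecord₁₃VAt`, `shellWeightBound_crOfRecord₁₃VAt`,
`core_crOfRecord₁₃VAt`, `schemeZ_eq_sum_classSet_weightA`, `schemeZ_succ_eq_sum_classSet_weightB` (p590105 ∕ p587226); `SpineCanonicalWeights.core_nonneg_of_shellWeightBound` (p586835);
dag-n19-d B‴ `ppSelLiveOfRecord` ∕ `LocalBgMeasurable` ∕ `ZetaMeasurable`; (P) p577468; (Q) p581033; dag-n17-a `s_N17_of_D4_N18`.  Nothing landed is edited or re-declared; p591895 stays as landed.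

HONEST FRAMING.  COMPOSITE-node bookkeeping BY NAME; no estimate; every displayed antecedent (the rates `P` ∕ the K4 sentences, the keyed N20 ∕ N21 ∕ N19′ WITNESSES at the
reading's carriers, the live-selector pin and the laws `LocalBgMeasurable ∕ ZetaMeasurable ∕ 0 ≤ ζ`) is a HYPOTHESIS inhabited for no family today; the shell split `sh` is NOT
inhabited here (NODE O ∕ N21's object); the cut reading `jc` is a FREE PARAMETER (print leaves `j⋆` free; v3: the prover's dial, no guard); NE7 ∕ NE7b ∕ NE7c NOT PRINTED for d = 4 and
NOT PROVED; nothing of Bałaban's asserted or instantiated; no `Provisos₁₃CoPH` inhabitant claimed (K0⁷ open); N19 ∕ N20 ∕ N21 ∕ N27 NOT discharged (the chair books, R417); K3⁷ NOT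
claimed; skeleton v3 is the plan's, untouched; counts UNMOVED (typed 28∕28 · discharged 5∕27, A 5∕28); one finite four-torus programme at fixed `ε` — NOT ℝ⁴, NOT infinite volume,
NOT OS, NOT a mass gap, NOT Clay.  No decl below carries a cite tag.
-/

set_option autoImplicit false

namespace Summit.QuantumFields.YangMills.Theorems.BalabanUVNodesN27SpineRecord

open scoped BigOperators
open Literature.MathematicalPhysics.QuantumFieldTheory.Balaban1983to89
open Literature.MathematicalPhysics.QuantumFieldTheory.Balaban1983to89.T4Continuum
open Literature.MathematicalPhysics.QuantumFieldTheory.Balaban1983to89.Node00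
open T4WeightBudget (RelWeightBound)
open T4IndicatorShell (ShellWeightBound)
open T4ContinuumYM4Torus (ForSmallCouplings)
open Summit.QuantumFields.BalabanUV.T4Continuum.Spine
open YMDAG.UVSplit
open Summit.QuantumFields.YangMills.BalabanUVNodes.SpineCanonicalWeights (core_nonneg_of_shellWeightBound)
open Summit.QuantumFields.YangMills.BalabanUVNodes.N19TargetClassWeightsE1Keyed
open Summit.QuantumFields.YangMills.BalabanUVNodes.N16HolderDefs (S_N16Holder)
open Summit.QuantumFields.YangMills.BalabanUVNodes.SpineRatesHolder (RatesHolderAt)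

variable {N : ℕ} [NeZero N] (K₀ : ℕ)
  (jc : (F : T4Family) → (θ : Stage13HParams F N) → θ.Provisos₁₃CoPH F N → (ℕ → ℝ) → List (ULoop F) → ℕ → ℕ)
  (sh : ShellSplit₁₃CoPH N K₀)

/-! ## §0 The extraction face at the per-tuple-cut reading (E1∕E2 do not read the cut) -/

/-- **THE EXTRACTION FACE AT `crOfRecord₁₃VAt K₀ (jc F θ hP g₀ os) sh`, every `g₀ os`, IS A THEOREM** under the live-selector pin and B‴ §2's three laws: `0 < l₀`, `0 < vol =
(2L^m)⁴`, E1 ∕ E2 — dag-n20-d's `schemeZ_eq_sum_classSet_weightA` ∕ `schemeZ_succ_eq_sum_classSet_weightB` BY NAME, `ForSmallCouplings.of_forall` (the per-tuple cut depth is not read: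
it only enters `Bad`). [bookkeeping] -/
theorem keyedExtraction_crOfRecord₁₃VAt_cut {F : T4Family} (θ : Stage13HParams F N) (hP : θ.Provisos₁₃CoPH F N) (E : B12.RunParams → ℝ)
    (hsel : θ.ppSel = ppSelLiveOfRecord F N θ.ν θ.τ9 E (wOfRecord₉ F N θ.toStage9Params))
    (hU : LocalBgMeasurable F N θ.ν) (hζm : ZetaMeasurable F N θ.ζ) (hζ0 : ∀ p g k s Pl Ql RS U V', 0 ≤ θ.ζ p g k s Pl Ql RS U V') :
    ForSmallCouplings (datumOfRecord₁₃CoPH F N θ hP) fun g₀ => ∀ os : List (ULoop F),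
      0 < (crOfRecord₁₃VAt K₀ (jc F θ hP g₀ os) sh F θ hP g₀ os).l₀ ∧ 0 < (crOfRecord₁₃VAt K₀ (jc F θ hP g₀ os) sh F θ hP g₀ os).vol ∧
      (∀ (K : ℕ) (t : ℝ), |t| ≤ (crOfRecord₁₃VAt K₀ (jc F θ hP g₀ os) sh F θ hP g₀ os).l₀ →
        T4GenFunBounds.schemeZ ((datumOfRecord₁₃CoPH F N θ hP).scheme g₀) os ((crOfRecord₁₃VAt K₀ (jc F θ hP g₀ os) sh F θ hP g₀ os).K₀ + K) t =
          ∑ τ ∈ (crOfRecord₁₃VAt K₀ (jc F θ hP g₀ os) sh F θ hP g₀ os).T K, (crOfRecord₁₃VAt K₀ (jc F θ hP g₀ os) sh F θ hP g₀ os).A K t τ) ∧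
      (∀ (K : ℕ) (t : ℝ), |t| ≤ (crOfRecord₁₃VAt K₀ (jc F θ hP g₀ os) sh F θ hP g₀ os).l₀ →
        T4GenFunBounds.schemeZ ((datumOfRecord₁₃CoPH F N θ hP).scheme g₀) os ((crOfRecord₁₃VAt K₀ (jc F θ hP g₀ os) sh F θ hP g₀ os).K₀ + K + 1) t =
          ∑ τ ∈ (crOfRecord₁₃VAt K₀ (jc F θ hP g₀ os) sh F θ hP g₀ os).T K, (crOfRecord₁₃VAt K₀ (jc F θ hP g₀ os) sh F θ hP g₀ os).B K t τ) :=
  ForSmallCouplings.of_forall fun g₀ os =>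
    ⟨one_pos, pow_pos F.side_pos 4, fun K t _ => schemeZ_eq_sum_classSet_weightA K₀ θ hP E hsel hU hζm hζ0 g₀ os K t,
      fun K t _ => schemeZ_succ_eq_sum_classSet_weightB K₀ θ hP E hsel hU hζm hζ0 g₀ os K t⟩

-- sanity (`rfl`, no decl): at offset `0` the per-tuple-cut reading IS v3's pinned witness `crOfRecord₁₃V (jc F θ hP g₀ os) sh F θ hP g₀ os` at every tuple
-- (dag-n20-d `crOfRecord₁₃V_eq`), so every `K₀`-generic face below instantiates at the skeleton's `PinnedAtLive jc sh cr` by unification.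
example (jc₀ : (F : T4Family) → (θ : Stage13HParams F N) → θ.Provisos₁₃CoPH F N → (ℕ → ℝ) → List (ULoop F) → ℕ → ℕ) (sh₀ : ShellSplit₁₃CoPH N 0)
    {F : T4Family} (θ : Stage13HParams F N) (hP : θ.Provisos₁₃CoPH F N) (g₀ : ℕ → ℝ) (os : List (ULoop F)) :
    (fun F θ hP g₀ os => crOfRecord₁₃VAt 0 (jc₀ F θ hP g₀ os) sh₀ F θ hP g₀ os) F θ hP g₀ os = crOfRecord₁₃V (jc₀ F θ hP g₀ os) sh₀ F θ hP g₀ os :=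
  rfl

variable (Rg : (F : T4Family) → Stage13HParams F N → Prop)

/-! ## §1 The keyed composer at the per-tuple-cut spine reading of record — arbitrary rates predicate `P`, arbitrary rate reading `rr` -/

section KeyedP

variable (rr : (F : T4Family) → (θ : Stage13HParams F N) → θ.Provisos₁₃CoPH F N → (ℕ → ℝ) → List (ULoop F) → RateCarriers N)
  (P : ∀ {F : T4Family}, Datum F N → RateCarriers N → Prop)

/-- ★★ **N27 = B5 AT THE REGIME RECORD CLASS WITH THE SPINE READING PINNED AT `fun F θ hP g₀ os ↦ crOfRecord₁₃VAt K₀ (jc F θ hP g₀ os) sh F θ hP g₀ os`** ((P)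
`spine_rec13CCoPHOn_of_keyedFacesP` at that `cr`; p591895 §1 with the cut READ PER TUPLE): for every family and every admissible Stage-13 tuple with provisos IN `Rg` — the
live-selector pin `hsel` and the laws `hU hζm hζ0` (⇒ the extraction slot, §0), a keyed `RelWeightBound`-witness `W` at the reading's carriers with bad class `badClass₁₃ θ K₀ g₀ (jc F θ hP g₀ os)`
(⇒ N20, `relWeightBound_crOfRecord₁₃VAt` at `jcut := jc F θ hP g₀ os`), a keyed `ShellWeightBound`-witness `Wsh` at the shell split `sh` (⇒ N21, `shellWeightBound_crOfRecord₁₃VAt`; cores ≥ 0), the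
rates `P (datumOfRecord₁₃CoPH F N θ hP) (rr F θ hP g₀ os)` (`hrates`) and the N19′ edge from them to SOME summable `NE7.Core 1 (F.side ^ 4)` rate at the shell-free cores with that bad class
(⇒ the edge at the reading's own `δ`, `core_crOfRecord₁₃VAt`) — give `Spine` at `IsRecordOfRecord₁₃CCoPHOn F N Rg`.  At `K₀ = 0` the spine reading is v3's `crOfRecord₁₃V (jc F θ hP g₀ os) sh`
per tuple (`crOfRecord₁₃V_eq`, `rfl`).  `hsel` is PER TUPLE (read off the regime on the live line, §3).  Every displayed antecedent a HYPOTHESIS (0∕1 today); `sh` not inhabited;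
`jc` free. [bookkeeping] -/
theorem spine_rec13CCoPHOn_at_crOfRecord₁₃VAt_cut_of_keyedFacesP
    (hsel : ∀ (F : T4Family) (θ : Stage13HParams F N), θ.Provisos₁₃CoPH F N → Rg F θ → θ.Admissible F N →
      ∃ E : B12.RunParams → ℝ, θ.ppSel = ppSelLiveOfRecord F N θ.ν θ.τ9 E (wOfRecord₉ F N θ.toStage9Params))
    (hU : ∀ (F : T4Family) (θ : Stage13HParams F N), θ.Provisos₁₃CoPH F N → Rg F θ → θ.Admissible F N → LocalBgMeasurable F N θ.ν)
    (hζm : ∀ (F : T4Family) (θ : Stage13HParams F N), θ.Provisos₁₃CoPH F N → Rg F θ → θ.Admissible F N → ZetaMeasurable F N θ.ζ)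
    (hζ0 : ∀ (F : T4Family) (θ : Stage13HParams F N), θ.Provisos₁₃CoPH F N → Rg F θ → θ.Admissible F N → ∀ p g k s Pl Ql RS U V', 0 ≤ θ.ζ p g k s Pl Ql RS U V')
    (h20 : ∀ (F : T4Family) (θ : Stage13HParams F N) (hP : θ.Provisos₁₃CoPH F N), Rg F θ → θ.Admissible F N → ∀ (g₀ : ℕ → ℝ) (os : List (ULoop F)),
      ∃ W : ℕ → ℝ, RelWeightBound 1 (classSet₁₃ θ K₀ g₀) (weightA₁₃ θ hP K₀ g₀ os) (weightB₁₃ θ hP K₀ g₀ os) (badClass₁₃ θ K₀ g₀ (jc F θ hP g₀ os)) W)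
    (h21 : ∀ (F : T4Family) (θ : Stage13HParams F N) (hP : θ.Provisos₁₃CoPH F N), Rg F θ → θ.Admissible F N → ∀ (g₀ : ℕ → ℝ) (os : List (ULoop F)),
      ∃ Wsh : ℕ → ℝ, ShellWeightBound 1 (classSet₁₃ θ K₀ g₀) (weightA₁₃ θ hP K₀ g₀ os) (weightB₁₃ θ hP K₀ g₀ os) (sh F θ hP g₀ os).1 (sh F θ hP g₀ os).2 Wsh)
    (hrates : ∀ (F : T4Family) (θ : Stage13HParams F N) (hP : θ.Provisos₁₃CoPH F N), Rg F θ → θ.Admissible F N → ∀ (g₀ : ℕ → ℝ) (os : List (ULoop F)),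
      P (datumOfRecord₁₃CoPH F N θ hP) (rr F θ hP g₀ os))
    (h19 : ∀ (F : T4Family) (θ : Stage13HParams F N) (hP : θ.Provisos₁₃CoPH F N), Rg F θ → θ.Admissible F N → ∀ (g₀ : ℕ → ℝ) (os : List (ULoop F)),
      P (datumOfRecord₁₃CoPH F N θ hP) (rr F θ hP g₀ os) → letI : DecidableEq (Σ K, SiteSeqKey F (K₀ + K)) := Classical.decEq _
        ∃ δ : ℕ → ℝ, NE7.Core 1 (F.side ^ 4) (classSet₁₃ θ K₀ g₀) (badClass₁₃ θ K₀ g₀ (jc F θ hP g₀ os)) (fun K t x => weightA₁₃ θ hP K₀ g₀ os K t x - (sh F θ hP g₀ os).1 K t x)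
          (fun K t x => weightB₁₃ θ hP K₀ g₀ os K t x - (sh F θ hP g₀ os).2 K t x) δ ∧ Summable δ) :
    Spine (N := N) fun F D w => Node00.IsRecordOfRecord₁₃CCoPHOn F N Rg D w :=
  spine_rec13CCoPHOn_of_keyedFacesP (cr := fun F θ hP g₀ os => crOfRecord₁₃VAt K₀ (jc F θ hP g₀ os) sh F θ hP g₀ os) (rr := rr) (Rg := Rg) (P := P)
    (fun F θ hP hRg hθ g₀ os => by
      obtain ⟨W, hW⟩ := h20 F θ hP hRg hθ g₀ os
      exact relWeightBound_crOfRecord₁₃VAt K₀ (jc F θ hP g₀ os) sh θ hP g₀ os hW)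
    (fun F θ hP hRg hθ g₀ os => by
      obtain ⟨Wsh, hWsh⟩ := h21 F θ hP hRg hθ g₀ os
      exact shellWeightBound_crOfRecord₁₃VAt K₀ (jc F θ hP g₀ os) sh θ hP g₀ os hWsh)
    hrates
    (fun F θ hP hRg hθ g₀ os hPr => by
      letI : DecidableEq (Σ K, SiteSeqKey F (K₀ + K)) := Classical.decEq _
      obtain ⟨Wsh, hWsh⟩ := h21 F θ hP hRg hθ g₀ os
      obtain ⟨δ, hδ, hsum⟩ := h19 F θ hP hRg hθ g₀ os hPr
      exact ⟨_, core_crOfRecord₁₃VAt K₀ (jc F θ hP g₀ os) sh θ hP g₀ os (core_nonneg_of_shellWeightBound hWsh) hδ hsum⟩)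
    (fun F θ hP hRg hθ _ _ => by
      obtain ⟨E, hE⟩ := hsel F θ hP hRg hθ
      exact keyedExtraction_crOfRecord₁₃VAt_cut K₀ jc sh θ hP E hE (hU F θ hP hRg hθ) (hζm F θ hP hRg hθ) (hζ0 F θ hP hRg hθ))

end KeyedP

/-! ## §2 Both homes by name: the K4 sentences at dag-n22-e's regime home of ANY Stage-13 rate reading (R-β, N17 glued), the K5 side at the per-tuple-cut spine reading -/

section Homes

variable (β : ℝ) (𝔯 : RateReading₁₃CoPH N)

/-- ★★ **N27 = B5 AT THE REGIME RECORD CLASS FROM THE K4 SENTENCES AT `RRec₁₃CoPHOn 𝔯 Rg` (N16 AT EXPONENT `β`, N17 GLUED) AND THE K5 SIDE AT THE PER-TUPLE-CUT READING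
`fun F θ hP g₀ os ↦ crOfRecord₁₃VAt K₀ (jc F θ hP g₀ os) sh F θ hP g₀ os`** ((Q) §1 `spine_rec13CCoPHOn_of_homes₁₃CoPHOn_holder` at that `cr`, `h17 := YMDAG.N17.s_N17_of_D4_N18 _ hD4 h18`;
p591895 §2 with the cut READ PER TUPLE): the five producer sentences + (D4), the keyed N20 ∕ N21 ∕ N19′ WITNESSES at the reading's carriers (bad class `badClass₁₃ θ K₀ g₀ (jc F θ hP g₀ os)`),
the live-selector pin and laws, and the N19′ edge reading `∀ k, RatesHolderAt (datumOfRecord₁₃CoPH F N θ hP) (rateCarriersOfRecord₁₃CoPH 𝔯 F θ hP g₀ os k) β` ⇒ `Spine` at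
`IsRecordOfRecord₁₃CCoPHOn F N Rg`.  Every displayed antecedent a HYPOTHESIS (0∕1 today); NE3 at exponent β NOT PROVED. [bookkeeping] -/
theorem spine_rec13CCoPHOn_of_homes₁₃CoPHOn_holder_at_crOfRecord₁₃VAt_cut
    (h14 : S_N14 (RRec₁₃CoPHOn 𝔯 Rg)) (h15 : S_N15 (RRec₁₃CoPHOn 𝔯 Rg)) (h16 : S_N16Holder β (RRec₁₃CoPHOn 𝔯 Rg))
    (h18 : S_N18 (RRec₁₃CoPHOn 𝔯 Rg)) (h22 : S_N22 (RRec₁₃CoPHOn 𝔯 Rg)) (hD4 : S_D4 (RRec₁₃CoPHOn 𝔯 Rg))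
    (hsel : ∀ (F : T4Family) (θ : Stage13HParams F N), θ.Provisos₁₃CoPH F N → Rg F θ → θ.Admissible F N →
      ∃ E : B12.RunParams → ℝ, θ.ppSel = ppSelLiveOfRecord F N θ.ν θ.τ9 E (wOfRecord₉ F N θ.toStage9Params))
    (hU : ∀ (F : T4Family) (θ : Stage13HParams F N), θ.Provisos₁₃CoPH F N → Rg F θ → θ.Admissible F N → LocalBgMeasurable F N θ.ν)
    (hζm : ∀ (F : T4Family) (θ : Stage13HParams F N), θ.Provisos₁₃CoPH F N → Rg F θ → θ.Admissible F N → ZetaMeasurable F N θ.ζ)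
    (hζ0 : ∀ (F : T4Family) (θ : Stage13HParams F N), θ.Provisos₁₃CoPH F N → Rg F θ → θ.Admissible F N → ∀ p g k s Pl Ql RS U V', 0 ≤ θ.ζ p g k s Pl Ql RS U V')
    (h20 : ∀ (F : T4Family) (θ : Stage13HParams F N) (hP : θ.Provisos₁₃CoPH F N), Rg F θ → θ.Admissible F N → ∀ (g₀ : ℕ → ℝ) (os : List (ULoop F)),
      ∃ W : ℕ → ℝ, RelWeightBound 1 (classSet₁₃ θ K₀ g₀) (weightA₁₃ θ hP K₀ g₀ os) (weightB₁₃ θ hP K₀ g₀ os) (badClass₁₃ θ K₀ g₀ (jc F θ hP g₀ os)) W)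
    (h21 : ∀ (F : T4Family) (θ : Stage13HParams F N) (hP : θ.Provisos₁₃CoPH F N), Rg F θ → θ.Admissible F N → ∀ (g₀ : ℕ → ℝ) (os : List (ULoop F)),
      ∃ Wsh : ℕ → ℝ, ShellWeightBound 1 (classSet₁₃ θ K₀ g₀) (weightA₁₃ θ hP K₀ g₀ os) (weightB₁₃ θ hP K₀ g₀ os) (sh F θ hP g₀ os).1 (sh F θ hP g₀ os).2 Wsh)
    (h19 : ∀ (F : T4Family) (θ : Stage13HParams F N) (hP : θ.Provisos₁₃CoPH F N), Rg F θ → θ.Admissible F N → ∀ (g₀ : ℕ → ℝ) (os : List (ULoop F)),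
      (∀ k : ℕ, RatesHolderAt (datumOfRecord₁₃CoPH F N θ hP) (rateCarriersOfRecord₁₃CoPH 𝔯 F θ hP g₀ os k) β) →
        letI : DecidableEq (Σ K, SiteSeqKey F (K₀ + K)) := Classical.decEq _
        ∃ δ : ℕ → ℝ, NE7.Core 1 (F.side ^ 4) (classSet₁₃ θ K₀ g₀) (badClass₁₃ θ K₀ g₀ (jc F θ hP g₀ os)) (fun K t x => weightA₁₃ θ hP K₀ g₀ os K t x - (sh F θ hP g₀ os).1 K t x)
          (fun K t x => weightB₁₃ θ hP K₀ g₀ os K t x - (sh F θ hP g₀ os).2 K t x) δ ∧ Summable δ) :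
    Spine (N := N) fun F D w => Node00.IsRecordOfRecord₁₃CCoPHOn F N Rg D w :=
  spine_rec13CCoPHOn_of_homes₁₃CoPHOn_holder (fun F θ hP g₀ os => crOfRecord₁₃VAt K₀ (jc F θ hP g₀ os) sh F θ hP g₀ os) β 𝔯 Rg h14 h15 h16
    (YMDAG.N17.s_N17_of_D4_N18 _ hD4 h18) h18 h22
    ((s_N20_sRec₁₃CoPHOn_iff (fun F θ hP g₀ os => crOfRecord₁₃VAt K₀ (jc F θ hP g₀ os) sh F θ hP g₀ os) Rg).mpr fun F θ hP hRg hθ g₀ os => by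
      obtain ⟨W, hW⟩ := h20 F θ hP hRg hθ g₀ os
      exact relWeightBound_crOfRecord₁₃VAt K₀ (jc F θ hP g₀ os) sh θ hP g₀ os hW)
    (by
      rintro F D g₀ os S ⟨θ, hP, hRg, hθ, -, rfl⟩
      obtain ⟨Wsh, hWsh⟩ := h21 F θ hP hRg hθ g₀ os
      exact shellWeightBound_crOfRecord₁₃VAt K₀ (jc F θ hP g₀ os) sh θ hP g₀ os hWsh)
    (fun F θ hP hRg hθ _ _ => by
      obtain ⟨E, hE⟩ := hsel F θ hP hRg hθ
      exact keyedExtraction_crOfRecord₁₃VAt_cut K₀ jc sh θ hP E hE (hU F θ hP hRg hθ) (hζm F θ hP hRg hθ) (hζ0 F θ hP hRg hθ))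
    (fun F θ hP hRg hθ g₀ os hk => by
      letI : DecidableEq (Σ K, SiteSeqKey F (K₀ + K)) := Classical.decEq _
      obtain ⟨Wsh, hWsh⟩ := h21 F θ hP hRg hθ g₀ os
      obtain ⟨δ, hδ, hsum⟩ := h19 F θ hP hRg hθ g₀ os hk
      exact ⟨_, core_crOfRecord₁₃VAt K₀ (jc F θ hP g₀ os) sh θ hP g₀ os (core_nonneg_of_shellWeightBound hWsh) hδ hsum⟩)

end Homes

/-! ## §3 The LIVE-SELECTOR LINE (v3 `LiveSel F θ := θ.ppSel = ppSelLiveOfRecord F 2 θ.ν θ.τ9 (EOfRecord₁₃ F 2 θ.toStage13Params) (wOfRecord₉ F 2 θ.toStage9Params)`, stub 2's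
`PinnedAtLive jc sh cr`): §1∕§2 at a regime INSIDE the live line — `hsel` DISCHARGED by the regime.  Off the live line: U `spine_rec13CCoPHOn_of_split` (p589453) + leaf HC. -/

section Live

variable (G : (F : T4Family) → Stage13HParams F N → Prop)

/-- ★★ **§1 ON THE LIVE LINE OF A REGIME `G`** — `Rg F θ := G F θ ∧ (θ.ppSel = ppSelLiveOfRecord F N θ.ν θ.τ9 (EOfRecord₁₃ F N θ.toStage13Params) (wOfRecord₉ F N θ.toStage9Params))`
(v3's `LiveSel` spelled `N`-generically): the live-selector pin is READ OFF THE REGIME, so the extraction slot at the per-tuple-cut reading costs only the laws `hU hζm hζ0`; rates `P`,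
keyed N20 ∕ N21 ∕ N19′ witnesses with bad class `badClass₁₃ θ K₀ g₀ (jc F θ hP g₀ os)` as in §1, all asked on the live part of `G` only — exactly what a v3 `stub_expansion13H` prover
working per tuple AT ITS OWN CUT DEPTH meets on the live line. [bookkeeping] -/
theorem spine_rec13CCoPHOn_live_at_crOfRecord₁₃VAt_cut_of_keyedFacesP
    (rr : (F : T4Family) → (θ : Stage13HParams F N) → θ.Provisos₁₃CoPH F N → (ℕ → ℝ) → List (ULoop F) → RateCarriers N)
    (P : ∀ {F : T4Family}, Datum F N → RateCarriers N → Prop)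
    (hU : ∀ (F : T4Family) (θ : Stage13HParams F N), θ.Provisos₁₃CoPH F N →
      (G F θ ∧ θ.ppSel = ppSelLiveOfRecord F N θ.ν θ.τ9 (EOfRecord₁₃ F N θ.toStage13Params) (wOfRecord₉ F N θ.toStage9Params)) → θ.Admissible F N → LocalBgMeasurable F N θ.ν)
    (hζm : ∀ (F : T4Family) (θ : Stage13HParams F N), θ.Provisos₁₃CoPH F N →
      (G F θ ∧ θ.ppSel = ppSelLiveOfRecord F N θ.ν θ.τ9 (EOfRecord₁₃ F N θ.toStage13Params) (wOfRecord₉ F N θ.toStage9Params)) → θ.Admissible F N → ZetaMeasurable F N θ.ζ)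
    (hζ0 : ∀ (F : T4Family) (θ : Stage13HParams F N), θ.Provisos₁₃CoPH F N →
      (G F θ ∧ θ.ppSel = ppSelLiveOfRecord F N θ.ν θ.τ9 (EOfRecord₁₃ F N θ.toStage13Params) (wOfRecord₉ F N θ.toStage9Params)) → θ.Admissible F N →
        ∀ p g k s Pl Ql RS U V', 0 ≤ θ.ζ p g k s Pl Ql RS U V')
    (h20 : ∀ (F : T4Family) (θ : Stage13HParams F N) (hP : θ.Provisos₁₃CoPH F N),
      (G F θ ∧ θ.ppSel = ppSelLiveOfRecord F N θ.ν θ.τ9 (EOfRecord₁₃ F N θ.toStage13Params) (wOfRecord₉ F N θ.toStage9Params)) → θ.Admissible F N →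
        ∀ (g₀ : ℕ → ℝ) (os : List (ULoop F)),
          ∃ W : ℕ → ℝ, RelWeightBound 1 (classSet₁₃ θ K₀ g₀) (weightA₁₃ θ hP K₀ g₀ os) (weightB₁₃ θ hP K₀ g₀ os) (badClass₁₃ θ K₀ g₀ (jc F θ hP g₀ os)) W)
    (h21 : ∀ (F : T4Family) (θ : Stage13HParams F N) (hP : θ.Provisos₁₃CoPH F N),
      (G F θ ∧ θ.ppSel = ppSelLiveOfRecord F N θ.ν θ.τ9 (EOfRecord₁₃ F N θ.toStage13Params) (wOfRecord₉ F N θ.toStage9Params)) → θ.Admissible F N →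
        ∀ (g₀ : ℕ → ℝ) (os : List (ULoop F)),
          ∃ Wsh : ℕ → ℝ, ShellWeightBound 1 (classSet₁₃ θ K₀ g₀) (weightA₁₃ θ hP K₀ g₀ os) (weightB₁₃ θ hP K₀ g₀ os) (sh F θ hP g₀ os).1 (sh F θ hP g₀ os).2 Wsh)
    (hrates : ∀ (F : T4Family) (θ : Stage13HParams F N) (hP : θ.Provisos₁₃CoPH F N),
      (G F θ ∧ θ.ppSel = ppSelLiveOfRecord F N θ.ν θ.τ9 (EOfRecord₁₃ F N θ.toStage13Params) (wOfRecord₉ F N θ.toStage9Params)) → θ.Admissible F N →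
        ∀ (g₀ : ℕ → ℝ) (os : List (ULoop F)), P (datumOfRecord₁₃CoPH F N θ hP) (rr F θ hP g₀ os))
    (h19 : ∀ (F : T4Family) (θ : Stage13HParams F N) (hP : θ.Provisos₁₃CoPH F N),
      (G F θ ∧ θ.ppSel = ppSelLiveOfRecord F N θ.ν θ.τ9 (EOfRecord₁₃ F N θ.toStage13Params) (wOfRecord₉ F N θ.toStage9Params)) → θ.Admissible F N →
        ∀ (g₀ : ℕ → ℝ) (os : List (ULoop F)), P (datumOfRecord₁₃CoPH F N θ hP) (rr F θ hP g₀ os) → letI : DecidableEq (Σ K, SiteSeqKey F (K₀ + K)) := Classical.decEq _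
          ∃ δ : ℕ → ℝ, NE7.Core 1 (F.side ^ 4) (classSet₁₃ θ K₀ g₀) (badClass₁₃ θ K₀ g₀ (jc F θ hP g₀ os)) (fun K t x => weightA₁₃ θ hP K₀ g₀ os K t x - (sh F θ hP g₀ os).1 K t x)
            (fun K t x => weightB₁₃ θ hP K₀ g₀ os K t x - (sh F θ hP g₀ os).2 K t x) δ ∧ Summable δ) :
    Spine (N := N) fun F D w => Node00.IsRecordOfRecord₁₃CCoPHOn F N
      (fun F θ => G F θ ∧ θ.ppSel = ppSelLiveOfRecord F N θ.ν θ.τ9 (EOfRecord₁₃ F N θ.toStage13Params) (wOfRecord₉ F N θ.toStage9Params)) D w :=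
  spine_rec13CCoPHOn_at_crOfRecord₁₃VAt_cut_of_keyedFacesP K₀ jc sh _ rr P (fun _ _ _ hRg _ => ⟨_, hRg.2⟩) hU hζm hζ0 h20 h21 hrates h19

/-- ★★ **§2 ON THE LIVE LINE OF A REGIME `G`**: the K4 sentences at `RRec₁₃CoPHOn 𝔯 (G ∧ LiveSel)` (N16 at exponent `β`, N17 glued), the K5 witnesses (bad class
`badClass₁₃ θ K₀ g₀ (jc F θ hP g₀ os)`) and laws on the live part, the N19′ edge reading `∀ k, RatesHolderAt …` — `hsel` read off the regime. [bookkeeping] -/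
theorem spine_rec13CCoPHOn_live_of_homes₁₃CoPHOn_holder_at_crOfRecord₁₃VAt_cut (β : ℝ) (𝔯 : RateReading₁₃CoPH N)
    (h14 : S_N14 (RRec₁₃CoPHOn 𝔯 fun F θ => G F θ ∧ θ.ppSel = ppSelLiveOfRecord F N θ.ν θ.τ9 (EOfRecord₁₃ F N θ.toStage13Params) (wOfRecord₉ F N θ.toStage9Params)))
    (h15 : S_N15 (RRec₁₃CoPHOn 𝔯 fun F θ => G F θ ∧ θ.ppSel = ppSelLiveOfRecord F N θ.ν θ.τ9 (EOfRecord₁₃ F N θ.toStage13Params) (wOfRecord₉ F N θ.toStage9Params)))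
    (h16 : S_N16Holder β (RRec₁₃CoPHOn 𝔯 fun F θ => G F θ ∧ θ.ppSel = ppSelLiveOfRecord F N θ.ν θ.τ9 (EOfRecord₁₃ F N θ.toStage13Params) (wOfRecord₉ F N θ.toStage9Params)))
    (h18 : S_N18 (RRec₁₃CoPHOn 𝔯 fun F θ => G F θ ∧ θ.ppSel = ppSelLiveOfRecord F N θ.ν θ.τ9 (EOfRecord₁₃ F N θ.toStage13Params) (wOfRecord₉ F N θ.toStage9Params)))
    (h22 : S_N22 (RRec₁₃CoPHOn 𝔯 fun F θ => G F θ ∧ θ.ppSel = ppSelLiveOfRecord F N θ.ν θ.τ9 (EOfRecord₁₃ F N θ.toStage13Params) (wOfRecord₉ F N θ.toStage9Params)))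
    (hD4 : S_D4 (RRec₁₃CoPHOn 𝔯 fun F θ => G F θ ∧ θ.ppSel = ppSelLiveOfRecord F N θ.ν θ.τ9 (EOfRecord₁₃ F N θ.toStage13Params) (wOfRecord₉ F N θ.toStage9Params)))
    (hU : ∀ (F : T4Family) (θ : Stage13HParams F N), θ.Provisos₁₃CoPH F N →
      (G F θ ∧ θ.ppSel = ppSelLiveOfRecord F N θ.ν θ.τ9 (EOfRecord₁₃ F N θ.toStage13Params) (wOfRecord₉ F N θ.toStage9Params)) → θ.Admissible F N → LocalBgMeasurable F N θ.ν)
    (hζm : ∀ (F : T4Family) (θ : Stage13HParams F N), θ.Provisos₁₃CoPH F N →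
      (G F θ ∧ θ.ppSel = ppSelLiveOfRecord F N θ.ν θ.τ9 (EOfRecord₁₃ F N θ.toStage13Params) (wOfRecord₉ F N θ.toStage9Params)) → θ.Admissible F N → ZetaMeasurable F N θ.ζ)
    (hζ0 : ∀ (F : T4Family) (θ : Stage13HParams F N), θ.Provisos₁₃CoPH F N →
      (G F θ ∧ θ.ppSel = ppSelLiveOfRecord F N θ.ν θ.τ9 (EOfRecord₁₃ F N θ.toStage13Params) (wOfRecord₉ F N θ.toStage9Params)) → θ.Admissible F N →
        ∀ p g k s Pl Ql RS U V', 0 ≤ θ.ζ p g k s Pl Ql RS U V')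
    (h20 : ∀ (F : T4Family) (θ : Stage13HParams F N) (hP : θ.Provisos₁₃CoPH F N),
      (G F θ ∧ θ.ppSel = ppSelLiveOfRecord F N θ.ν θ.τ9 (EOfRecord₁₃ F N θ.toStage13Params) (wOfRecord₉ F N θ.toStage9Params)) → θ.Admissible F N →
        ∀ (g₀ : ℕ → ℝ) (os : List (ULoop F)),
          ∃ W : ℕ → ℝ, RelWeightBound 1 (classSet₁₃ θ K₀ g₀) (weightA₁₃ θ hP K₀ g₀ os) (weightB₁₃ θ hP K₀ g₀ os) (badClass₁₃ θ K₀ g₀ (jc F θ hP g₀ os)) W)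
    (h21 : ∀ (F : T4Family) (θ : Stage13HParams F N) (hP : θ.Provisos₁₃CoPH F N),
      (G F θ ∧ θ.ppSel = ppSelLiveOfRecord F N θ.ν θ.τ9 (EOfRecord₁₃ F N θ.toStage13Params) (wOfRecord₉ F N θ.toStage9Params)) → θ.Admissible F N →
        ∀ (g₀ : ℕ → ℝ) (os : List (ULoop F)),
          ∃ Wsh : ℕ → ℝ, ShellWeightBound 1 (classSet₁₃ θ K₀ g₀) (weightA₁₃ θ hP K₀ g₀ os) (weightB₁₃ θ hP K₀ g₀ os) (sh F θ hP g₀ os).1 (sh F θ hP g₀ os).2 Wsh)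
    (h19 : ∀ (F : T4Family) (θ : Stage13HParams F N) (hP : θ.Provisos₁₃CoPH F N),
      (G F θ ∧ θ.ppSel = ppSelLiveOfRecord F N θ.ν θ.τ9 (EOfRecord₁₃ F N θ.toStage13Params) (wOfRecord₉ F N θ.toStage9Params)) → θ.Admissible F N →
        ∀ (g₀ : ℕ → ℝ) (os : List (ULoop F)),
          (∀ k : ℕ, RatesHolderAt (datumOfRecord₁₃CoPH F N θ hP) (rateCarriersOfRecord₁₃CoPH 𝔯 F θ hP g₀ os k) β) →
            letI : DecidableEq (Σ K, SiteSeqKey F (K₀ + K)) := Classical.decEq _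
            ∃ δ : ℕ → ℝ, NE7.Core 1 (F.side ^ 4) (classSet₁₃ θ K₀ g₀) (badClass₁₃ θ K₀ g₀ (jc F θ hP g₀ os)) (fun K t x => weightA₁₃ θ hP K₀ g₀ os K t x - (sh F θ hP g₀ os).1 K t x)
              (fun K t x => weightB₁₃ θ hP K₀ g₀ os K t x - (sh F θ hP g₀ os).2 K t x) δ ∧ Summable δ) :
    Spine (N := N) fun F D w => Node00.IsRecordOfRecord₁₃CCoPHOn F N
      (fun F θ => G F θ ∧ θ.ppSel = ppSelLiveOfRecord F N θ.ν θ.τ9 (EOfRecord₁₃ F N θ.toStage13Params) (wOfRecord₉ F N θ.toStage9Params)) D w :=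
  spine_rec13CCoPHOn_of_homes₁₃CoPHOn_holder_at_crOfRecord₁₃VAt_cut K₀ jc sh _ β 𝔯 h14 h15 h16 h18 h22 hD4 (fun _ _ _ hRg _ => ⟨_, hRg.2⟩) hU hζm hζ0 h20 h21 h19

end Live

end Summit.QuantumFields.YangMills.Theorems.BalabanUVNodesN27SpineRecord
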